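import Summits.QuantumFields.YangMills.Theorems.UnitScaleTiltProp7TrueLinSourcedDefectL1
import HarnessLib

/-!
# Route `UnitScaleTilt`, crux K1 «MinimiserStabilityRegPr» (stmt-QuantumFields-19200), route-R [RP] curved, row (n3) N3b, file 2d —
# THE TWO-CHANNEL DAMPED `ℓ¹` ENGINE: the coarse-gauge channel `Λ^D` read in OSCILLATION currency.  Given ANY oscillation functional `osc` (subadditive, dominated by
# `c₀·‖·‖_{ℓ¹}`) and the two one-level rows `Σ_z‖CM_jZ(z)‖ ≤ c₁·osc_j(Z) + c₂·w_j·‖Z‖_{ℓ¹}` (comb mean kills direction constants) and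
# `osc_{j+1}(LINE_jZ) ≤ ρ₂·osc_j(Z) + c₃·w_j·‖Z‖_{ℓ¹}` (straight means damp oscillation; leak weights `w_j`), the sourced family obeys, with ALL DAMPED WEIGHTS DISPLAYED,
# `‖D_k‖_{ℓ¹} ≤ E_k·u_k + 2d·Σ_{j<k}[c₁·(ρ₂ʲ·osc_0(D_0) + Σ_{i<j}ρ₂^{j−1−i}·((c₀κ₁a_i + c₃w_i)·E_i·u_i + osc_{i+1}(R_i))) + c₂·w_j·E_j·u_j]`, `u_j = ρ₁ʲ‖D_0‖_{ℓ¹} + Σ_{i<j}ρ₁^{j−1−i}‖R_i‖_{ℓ¹}`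

Cell `ym3-torus`, D-0154 (3c) extra-width seat `ym-routeR-w6` (gen 3); sequel of files 1a ∕ 1b (✓ `…Prop7TrueLinSourcedDefectL1Rows` ∕ ✓ `…Prop7TrueLinSourcedDefectL1`), answering
LEAD ★p1 g13's located «LOG-TOWER» hazard (2026-08-28 13:42Z ∕ 13:43Z ∕ 13:46Z: NAMED row 2d).  THEOREMS ONLY (0 `def`, 0 `sorry`); `--supports stmt-QuantumFields-19200`,
count-neutral.  YM₃ on T³ is a ladder rung (R3), not the Clay problem; nothing here claims the stub, the crux, d = 4 or the mass gap.

THE POINT.  File 1b's `Λ`-channel reads the covariant comb mean with the MASS row (✓ 1a `sum_norm_covCombMean_le`, constant `(d+2)L` at every level), so its bound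
`2d·Σ_{j<k}(d+2)L·E_j·(ρ₁ʲg₀ + S_j)` collects every level's source once, undamped: for a SMOOTH chart direction the one-step log-currency sources are `≈ c·M∕ℓ` at EVERY
level (LEAD's count), and the sum is `≈ k·c·M∕ℓ` — a `log ℓ` the door's window cannot absorb.  The cure (LEAD 13:43Z): the comb mean of a field kills its direction constants
(flat letters ✓ `Prop7CombMeanCentred.norm_combMean_le_osc`; centred blocks, `L` odd, mirror pairing of the stair words), so `‖CM_jZ‖_{ℓ¹}` is an OSCILLATION of `Z` plus an
`a_j`-small mass leak, and the oscillation of the reduced family is itself DAMPED along the tower (straight means of an `L`-to-one family: `osc(LINE_jZ) ≤ ρ₂·osc(Z)` + leak,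
`ρ₂ = L^{2−d}`; the defect part is dominated by its mass, `≤ c₀·‖Def_jZ‖_{ℓ¹} ≤ c₀κ₁a_j‖Z‖_{ℓ¹}` by ✓ 1a `sum_norm_defect_le`).  This file is the BOOKKEEPING of that cure over
file 1b, with the oscillation functional ABSTRACT (`osc : (j : ℕ) → (PBond P j → M_n(ℂ)) → ℝ`, nonnegative, subadditive, `osc_{j+1} ≤ c₀·‖·‖_{ℓ¹}`) and the two one-level
rows DISPLAYED as hypotheses quantified over all fields (their suppliers: LEAD's covariant CM-osc brick (i) and the LINE-osc row (ii-a), by name when they land): three real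
recursions `g_{j+1} ≤ (ρ₁ + κ₁a_j)g_j + r_j` (✓ 1b), `o_{j+1} ≤ ρ₂o_j + (c₀κ₁a_j + c₃w_j)g_j + s_j` (§2), `λ_k ≤ Σ_{j<k}(c₁o_j + c₂w_jg_j)` (§3), and `‖D_k‖_{ℓ¹} ≤ g_k + 2dλ_k`
(✓ A1).  With a smooth direction's profile (`r_i ≈ cM∕ℓ`, `s_i ≈ (L^{i+1}∕ℓ)r_i`, `a_j` geometric from the top) every level sum on the right is GEOMETRIC — no `k·`.

WHAT IS PROVED (ns `…Theorems.Prop7TrueLinSourcedOscL1`; `SU`-type background of any rank `n`, any `P`; `T_j`, `LINE_j`, `Def_j`, `CM_j` WRITTEN OUT as in 1a ∕ 1b ∕ A1).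
* §1 `damped_recursion_bound` — reals: `o_{j+1} ≤ ρ·o_j + t_j ⇒ o_k ≤ ρᵏo_0 + Σ_{j<k}ρ^{k−1−j}t_j` (✓ 1a `sourced_recursion_bound_init` at `κ = 0`).
* §2 ★ `osc_sourcedReduced_succ_le` — the one-step oscillation row of the sourced reduced family.
* §3 ★ `sum_norm_sourcedGauge_le_osc` — the coarse gauge function in `ℓ¹` through the OSCILLATION row of the comb mean.
* §4 ★★ `sum_norm_sourced_le_osc` — the title (all damped weights displayed; `G 0 = D 0` any initial field).
HONEST SCOPE.  Bookkeeping only: the oscillation functional and its two one-level rows are HYPOTHESES here (displayed, quantified over all fields); nothing of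
[Balaban1984PropagatorsI] ∕ [Balaban1985Averaging] is asserted beyond the cited tree theorems.  The level sums against a concrete source profile are the consumer's.

References: T. Bałaban, CMP 95 (1984) 17–40 [Balaban1984PropagatorsI] ((1.11), (1.18)–(1.20) pp.19–20); CMP 98 (1985) 17–51 [Balaban1985Averaging] (Prop. 3
(124)–(126) p.36); CMP 102 (1985) 277–309 [Balaban1985Variational] (Prop. 7 p.299); CMP 109 (1987) 249–301 [Balaban1987RG1] ((0.3)–(0.4) pp.252–253).
-/

set_option autoImplicit false

noncomputable section

open scoped BigOperators Matrix.Norms.L2Operator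

namespace Summit.QuantumFields.YangMills.Theorems.Prop7TrueLinSourcedOscL1

open Literature.MathematicalPhysics.QuantumFieldTheory.Balaban1983to89
open Finset T4Continuum BlockAveraging AveragingRT ExpMeanLog BlockAveragingEMLLinearised BlockAveragingEMLLinearisedBackground BlockAveragingEMLProp2
open Summit.QuantumFields.YangMills.Theorems.Prop7TrueLinSourcedDefectL1Rows (sum_norm_defect_le sourced_recursion_bound_init sum_levels_geom_le)
open Summit.QuantumFields.YangMills.Theorems.Prop7TrueLinSourcedDefectL1 (sum_norm_sourcedReduced_le sum_norm_le_sum_levels)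
open Summit.QuantumFields.YangMills.Theorems.Prop7TrueLinSourcedStructure (norm_le_of_sourced_structure)
open Summit.QuantumFields.YangMills.Theorems.Prop7PinnedFlatCoercivity (sum_pbond_tgt_add_src)

variable {P : Params} {n : Type*} [Fintype n] [DecidableEq n] [Nonempty n]

/-! ## §1 Reals: the damped recursion -/

omit [Fintype n] [DecidableEq n] [Nonempty n] in
/-- **DAMPED RECURSION**: `o (j+1) ≤ ρ·o j + t j` (`ρ > 0`, `o j, t j ≥ 0`) ⇒ `o k ≤ ρᵏ·o 0 + Σ_{j<k} ρ^{k−1−j}·t j` (✓ `sourced_recursion_bound_init` at `κ = 0`). [folklore] -/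
theorem damped_recursion_bound {ρ : ℝ} (hρ : 0 < ρ) (o t : ℕ → ℝ) (ho : ∀ j, 0 ≤ o j) (ht : ∀ j, 0 ≤ t j) (k : ℕ)
    (hrow : ∀ j < k, o (j + 1) ≤ ρ * o j + t j) :
    o k ≤ ρ ^ k * o 0 + ∑ j ∈ Finset.range k, ρ ^ (k - 1 - j) * t j := by
  have h := sourced_recursion_bound_init hρ le_rfl (fun _ => (0 : ℝ)) o t (fun _ => le_rfl) ho ht k
    (fun j hj => by simpa using hrow j hj)
  simpa using h

/-! ## §2 ★ The one-step oscillation row of the sourced reduced family -/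

section OscRow

variable (U₀ : GaugeField P 0 (Matrix.specialUnitaryGroup n ℂ)) (R : (k : ℕ) → PBond P (k + 1) → Matrix n n ℂ)
  (G : (k : ℕ) → PBond P k → Matrix n n ℂ)
  (hGs : ∀ (k : ℕ) (c : PBond P (k + 1)), G (k + 1) c
      = (fderiv ℂ (eml : (Idx P → Matrix n n ℂ) → Matrix n n ℂ)
            (fun i => ((loopHol (Averaging.iter (fun i => blockAvg (P := P) (j := i) (expMeanLogSU (n := n))) k U₀) c i : Matrix.specialUnitaryGroup n ℂ) : Matrix n n ℂ))
            (fun i => covWalkSum (Averaging.iter (fun i => blockAvg (P := P) (j := i) (expMeanLogSU (n := n))) k U₀) (G k) (walk (emb c.src) (loopWord P.L c.dir (off i.1) i.2.1 i.2.2))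
              * ((loopHol (Averaging.iter (fun i => blockAvg (P := P) (j := i) (expMeanLogSU (n := n))) k U₀) c i : Matrix.specialUnitaryGroup n ℂ) : Matrix n n ℂ))
            * star ((corr (expMeanLogSU (n := n)) (Averaging.iter (fun i => blockAvg (P := P) (j := i) (expMeanLogSU (n := n))) k U₀) c : Matrix.specialUnitaryGroup n ℂ) : Matrix n n ℂ)
          + ((corr (expMeanLogSU (n := n)) (Averaging.iter (fun i => blockAvg (P := P) (j := i) (expMeanLogSU (n := n))) k U₀) c : Matrix.specialUnitaryGroup n ℂ) : Matrix n n ℂ)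
            * covWalkSum (Averaging.iter (fun i => blockAvg (P := P) (j := i) (expMeanLogSU (n := n))) k U₀) (G k) (walk (emb c.src) (List.replicate P.L (c.dir, true)))
            * star ((corr (expMeanLogSU (n := n)) (Averaging.iter (fun i => blockAvg (P := P) (j := i) (expMeanLogSU (n := n))) k U₀) c : Matrix.specialUnitaryGroup n ℂ) : Matrix n n ℂ))
        - ((((Fintype.card (Idx P) : ℂ))⁻¹ • ∑ i : Idx P,
              covWalkSum (Averaging.iter (fun i => blockAvg (P := P) (j := i) (expMeanLogSU (n := n))) k U₀) (G k) (walk (emb c.src) (stairWord i.2.1 (off i.1))))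
            - ((Averaging.iter (fun i => blockAvg (P := P) (j := i) (expMeanLogSU (n := n))) (k + 1) U₀ c : Matrix.specialUnitaryGroup n ℂ) : Matrix n n ℂ)
              * (((Fintype.card (Idx P) : ℂ))⁻¹ • ∑ i : Idx P,
              covWalkSum (Averaging.iter (fun i => blockAvg (P := P) (j := i) (expMeanLogSU (n := n))) k U₀) (G k) (walk (emb c.tgt) (stairWord i.2.1 (off i.1))))
              * star ((Averaging.iter (fun i => blockAvg (P := P) (j := i) (expMeanLogSU (n := n))) (k + 1) U₀ c : Matrix.specialUnitaryGroup n ℂ) : Matrix n n ℂ))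
        + R k c)
  (osc : (j : ℕ) → (PBond P j → Matrix n n ℂ) → ℝ)
  (hosc_add : ∀ (j : ℕ) (A B : PBond P j → Matrix n n ℂ), osc j (A + B) ≤ osc j A + osc j B)
  {c₀ : ℝ} (hc₀ : 0 ≤ c₀) (hosc_le : ∀ (j : ℕ) (W : PBond P (j + 1) → Matrix n n ℂ), osc (j + 1) W ≤ c₀ * ∑ c : PBond P (j + 1), ‖W c‖)

include hGs hosc_add hc₀ hosc_le in
/-- ★ **THE ONE-STEP OSCILLATION ROW**: at a level `j + 1 ≤ m + K` whose background loop variables are within `α ≤ 1/24` (`0 ≤ α < δ_N`) of `1`, if the straight-line mean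
damps the oscillation functional (`osc_{j+1}(LINE_jZ) ≤ ρ₂·osc_j(Z) + c₃·β·‖Z‖_{ℓ¹}` for every `Z`, leak weight `β`), then for the sourced reduced family
`osc_{j+1}(G_{j+1}) ≤ ρ₂·osc_j(G_j) + (c₀·(159(d+2)L·2d)·α + c₃·β)·Σ_c‖G_j c‖ + osc_{j+1}(R_j)` — decomposition `G_{j+1} = Def_jG_j + LINE_jG_j + R_j`, subadditivity, the mass
domination of `osc` on the defect (✓ 1a `sum_norm_defect_le`) and the displayed LINE row. [cite: Balaban1985Averaging, Prop. 3 (124)-(126) p.36] -/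
theorem osc_sourcedReduced_succ_le {j : ℕ} (hj1 : j + 1 ≤ P.m + P.K) {α : ℝ} (hα0 : 0 ≤ α)
    (hα : ∀ (c : PBond P (j + 1)) (i : Idx P), dist1 (loopHol (Averaging.iter (fun i => blockAvg (P := P) (j := i) (expMeanLogSU (n := n))) j U₀) c i) ≤ α)
    (hα24 : α ≤ 1 / 24) (hαN : α < deltaSU n) {ρ₂ c₃ β : ℝ}
    (hLINE : ∀ Z : PBond P j → Matrix n n ℂ, osc (j + 1) (fun c => (((Fintype.card (Idx P) : ℂ))⁻¹ • ∑ i : Idx P,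
          ((holAt (Averaging.iter (fun i => blockAvg (P := P) (j := i) (expMeanLogSU (n := n))) j U₀) (walk (emb c.src) (stairWord i.2.1 (off i.1))) : Matrix.specialUnitaryGroup n ℂ) : Matrix n n ℂ) *
            covWalkSum (Averaging.iter (fun i => blockAvg (P := P) (j := i) (expMeanLogSU (n := n))) j U₀) Z (walk (walkEnd (emb c.src) (stairWord i.2.1 (off i.1))) (List.replicate P.L (c.dir, true))) *
          star ((holAt (Averaging.iter (fun i => blockAvg (P := P) (j := i) (expMeanLogSU (n := n))) j U₀) (walk (emb c.src) (stairWord i.2.1 (off i.1))) : Matrix.specialUnitaryGroup n ℂ) : Matrix n n ℂ))) ≤ ρ₂ * osc j Z + c₃ * β * ∑ b : PBond P j, ‖Z b‖) :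
    osc (j + 1) (G (j + 1)) ≤ ρ₂ * osc j (G j) + (c₀ * (159 * (((P.d + 2) * P.L : ℕ) : ℝ) * (2 * P.d)) * α + c₃ * β) * ∑ c : PBond P j, ‖G j c‖ + osc (j + 1) (R j) := by
  set V := Averaging.iter (fun i => blockAvg (P := P) (j := i) (expMeanLogSU (n := n))) j U₀ with hV
  set D : PBond P (j + 1) → Matrix n n ℂ := fun c =>
    ((fderiv ℂ (eml : (Idx P → Matrix n n ℂ) → Matrix n n ℂ)
            (fun i => ((loopHol V c i : Matrix.specialUnitaryGroup n ℂ) : Matrix n n ℂ))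
            (fun i => covWalkSum V (G j) (walk (emb c.src) (loopWord P.L c.dir (off i.1) i.2.1 i.2.2))
              * ((loopHol V c i : Matrix.specialUnitaryGroup n ℂ) : Matrix n n ℂ))
            * star ((corr (expMeanLogSU (n := n)) V c : Matrix.specialUnitaryGroup n ℂ) : Matrix n n ℂ)
          + ((corr (expMeanLogSU (n := n)) V c : Matrix.specialUnitaryGroup n ℂ) : Matrix n n ℂ)
            * covWalkSum V (G j) (walk (emb c.src) (List.replicate P.L (c.dir, true)))
            * star ((corr (expMeanLogSU (n := n)) V c : Matrix.specialUnitaryGroup n ℂ) : Matrix n n ℂ))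
      - (((((Fintype.card (Idx P) : ℂ))⁻¹ • ∑ i : Idx P,
              covWalkSum V (G j) (walk (emb c.src) (stairWord i.2.1 (off i.1)))))
          - ((avgFun (expMeanLogSU (n := n)) V c : Matrix.specialUnitaryGroup n ℂ) : Matrix n n ℂ)
              * ((((Fintype.card (Idx P) : ℂ))⁻¹ • ∑ i : Idx P,
              covWalkSum V (G j) (walk (emb c.tgt) (stairWord i.2.1 (off i.1)))))
              * star ((avgFun (expMeanLogSU (n := n)) V c : Matrix.specialUnitaryGroup n ℂ) : Matrix n n ℂ))
      - (((Fintype.card (Idx P) : ℂ))⁻¹ • ∑ i : Idx P,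
          ((holAt V (walk (emb c.src) (stairWord i.2.1 (off i.1))) : Matrix.specialUnitaryGroup n ℂ) : Matrix n n ℂ) *
            covWalkSum V (G j) (walk (walkEnd (emb c.src) (stairWord i.2.1 (off i.1))) (List.replicate P.L (c.dir, true))) *
          star ((holAt V (walk (emb c.src) (stairWord i.2.1 (off i.1))) : Matrix.specialUnitaryGroup n ℂ) : Matrix n n ℂ))) with hD
  set LG : PBond P (j + 1) → Matrix n n ℂ := fun c => (((Fintype.card (Idx P) : ℂ))⁻¹ • ∑ i : Idx P,
          ((holAt V (walk (emb c.src) (stairWord i.2.1 (off i.1))) : Matrix.specialUnitaryGroup n ℂ) : Matrix n n ℂ) *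
            covWalkSum V (G j) (walk (walkEnd (emb c.src) (stairWord i.2.1 (off i.1))) (List.replicate P.L (c.dir, true))) *
          star ((holAt V (walk (emb c.src) (stairWord i.2.1 (off i.1))) : Matrix.specialUnitaryGroup n ℂ) : Matrix n n ℂ)) with hLG
  have hiter : Averaging.iter (fun i => blockAvg (P := P) (j := i) (expMeanLogSU (n := n))) (j + 1) U₀ = avgFun (expMeanLogSU (n := n)) V := rfl
  have hdec : ∀ c, G (j + 1) c = (D c + LG c) + R j c := by
    intro c
    rw [hGs, hiter]
    simp only [hD, hLG]
    abel
  have hfun : G (j + 1) = (D + LG) + R j := funext fun c => by rw [hdec c]; rfl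
  have hDrow : ∑ c, ‖D c‖ ≤ 159 * α * (((P.d + 2) * P.L : ℕ) : ℝ) * (2 * P.d) * ∑ c, ‖G j c‖ := by
    have h := sum_norm_defect_le hj1 V (G j) hα0 hα hα24 hαN
    simpa only [hD] using h
  have hLGrow : osc (j + 1) LG ≤ ρ₂ * osc j (G j) + c₃ * β * ∑ b : PBond P j, ‖G j b‖ := by
    have h := hLINE (G j)
    simpa only [hLG] using h
  have hDosc : osc (j + 1) D ≤ c₀ * (159 * α * (((P.d + 2) * P.L : ℕ) : ℝ) * (2 * P.d) * ∑ c, ‖G j c‖) :=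
    (hosc_le j D).trans (mul_le_mul_of_nonneg_left hDrow hc₀)
  calc osc (j + 1) (G (j + 1)) = osc (j + 1) ((D + LG) + R j) := by rw [hfun]
    _ ≤ osc (j + 1) (D + LG) + osc (j + 1) (R j) := hosc_add _ _ _
    _ ≤ (osc (j + 1) D + osc (j + 1) LG) + osc (j + 1) (R j) := add_le_add (hosc_add _ _ _) le_rfl
    _ ≤ (c₀ * (159 * α * (((P.d + 2) * P.L : ℕ) : ℝ) * (2 * P.d) * ∑ c, ‖G j c‖) + (ρ₂ * osc j (G j) + c₃ * β * ∑ b : PBond P j, ‖G j b‖))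
          + osc (j + 1) (R j) := add_le_add (add_le_add hDosc hLGrow) le_rfl
    _ = _ := by ring

end OscRow

/-! ## §3 ★ The coarse gauge function through the oscillation row of the comb mean -/

section Gauge

variable (U₀ : GaugeField P 0 (Matrix.specialUnitaryGroup n ℂ)) (G : (k : ℕ) → PBond P k → Matrix n n ℂ) (Λ : (k : ℕ) → Site P k → Matrix n n ℂ)
  (hΛ0 : ∀ y, Λ 0 y = 0)
  (hΛs : ∀ (k : ℕ) (z : Site P (k + 1)), Λ (k + 1) z
    = (((Fintype.card (Idx P) : ℂ))⁻¹ • ∑ i : Idx P,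
              covWalkSum (Averaging.iter (fun i => blockAvg (P := P) (j := i) (expMeanLogSU (n := n))) k U₀) (G k) (walk (emb z) (stairWord i.2.1 (off i.1))))
      + Λ k (emb z))
  (osc : (j : ℕ) → (PBond P j → Matrix n n ℂ) → ℝ)

include hΛ0 hΛs in
/-- ★ **THE COARSE GAUGE FUNCTION IN `ℓ¹`, OSCILLATION READING**: if at every level `j < k` the covariant comb mean obeys `Σ_z‖CM_jZ(z)‖ ≤ c₁·osc_j(Z) + c₂·w_j·Σ_b‖Z b‖` for
every `Z` (leak weights `w_j`), then `Σ_y‖Λ_k(y)‖ ≤ Σ_{j<k}(c₁·osc_j(G_j) + c₂·w_j·Σ_c‖G_j c‖)` (`k ≤ m + K`; the levels add along the injective `emb`, ✓ 1b `sum_norm_le_sum_levels`).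
[cite: Balaban1984PropagatorsI, (1.18)-(1.20) pp.19-20] -/
theorem sum_norm_sourcedGauge_le_osc (w : ℕ → ℝ) {c₁ c₂ : ℝ} {k : ℕ} (hk : k ≤ P.m + P.K)
    (hCM : ∀ j < k, ∀ Z : PBond P j → Matrix n n ℂ, ∑ z : Site P (j + 1), ‖(((Fintype.card (Idx P) : ℂ))⁻¹ • ∑ i : Idx P,
              covWalkSum (Averaging.iter (fun i => blockAvg (P := P) (j := i) (expMeanLogSU (n := n))) j U₀) Z (walk (emb z) (stairWord i.2.1 (off i.1))))‖ ≤ c₁ * osc j Z + c₂ * w j * ∑ b : PBond P j, ‖Z b‖) :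
    ∑ y : Site P k, ‖Λ k y‖ ≤ ∑ j ∈ Finset.range k, (c₁ * osc j (G j) + c₂ * w j * ∑ c : PBond P j, ‖G j c‖) := by
  have ht := Prop7CovIterLambdaBound.norm_le_of_rec_eq Λ (fun j z => (((Fintype.card (Idx P) : ℂ))⁻¹ • ∑ i : Idx P,
              covWalkSum (Averaging.iter (fun i => blockAvg (P := P) (j := i) (expMeanLogSU (n := n))) j U₀) (G j) (walk (emb z) (stairWord i.2.1 (off i.1))))) hΛs
  have hmain := sum_norm_le_sum_levels Λ hΛ0 (fun j z => ‖(((Fintype.card (Idx P) : ℂ))⁻¹ • ∑ i : Idx P,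
              covWalkSum (Averaging.iter (fun i => blockAvg (P := P) (j := i) (expMeanLogSU (n := n))) j U₀) (G j) (walk (emb z) (stairWord i.2.1 (off i.1))))‖) ht k hk
  refine hmain.trans (Finset.sum_le_sum fun j hj => ?_)
  exact hCM j (Finset.mem_range.mp hj) (G j)

end Gauge

/-! ## §4 ★★ The two-channel damped engine -/

section Assembly

variable (U₀ : GaugeField P 0 (Matrix.specialUnitaryGroup n ℂ)) (R : (k : ℕ) → PBond P (k + 1) → Matrix n n ℂ)
  (D : (k : ℕ) → PBond P k → Matrix n n ℂ)
  (hDs : ∀ (k : ℕ) (c : PBond P (k + 1)), D (k + 1) c = (fderiv ℂ (eml : (Idx P → Matrix n n ℂ) → Matrix n n ℂ)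
            (fun i => ((loopHol (Averaging.iter (fun i => blockAvg (P := P) (j := i) (expMeanLogSU (n := n))) k U₀) c i : Matrix.specialUnitaryGroup n ℂ) : Matrix n n ℂ))
            (fun i => covWalkSum (Averaging.iter (fun i => blockAvg (P := P) (j := i) (expMeanLogSU (n := n))) k U₀) (D k) (walk (emb c.src) (loopWord P.L c.dir (off i.1) i.2.1 i.2.2))
              * ((loopHol (Averaging.iter (fun i => blockAvg (P := P) (j := i) (expMeanLogSU (n := n))) k U₀) c i : Matrix.specialUnitaryGroup n ℂ) : Matrix n n ℂ))
            * star ((corr (expMeanLogSU (n := n)) (Averaging.iter (fun i => blockAvg (P := P) (j := i) (expMeanLogSU (n := n))) k U₀) c : Matrix.specialUnitaryGroup n ℂ) : Matrix n n ℂ)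
          + ((corr (expMeanLogSU (n := n)) (Averaging.iter (fun i => blockAvg (P := P) (j := i) (expMeanLogSU (n := n))) k U₀) c : Matrix.specialUnitaryGroup n ℂ) : Matrix n n ℂ)
            * covWalkSum (Averaging.iter (fun i => blockAvg (P := P) (j := i) (expMeanLogSU (n := n))) k U₀) (D k) (walk (emb c.src) (List.replicate P.L (c.dir, true)))
            * star ((corr (expMeanLogSU (n := n)) (Averaging.iter (fun i => blockAvg (P := P) (j := i) (expMeanLogSU (n := n))) k U₀) c : Matrix.specialUnitaryGroup n ℂ) : Matrix n n ℂ)) + R k c)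
  (G : (k : ℕ) → PBond P k → Matrix n n ℂ) (hG0 : ∀ b, G 0 b = D 0 b)
  (hGs : ∀ (k : ℕ) (c : PBond P (k + 1)), G (k + 1) c
      = (fderiv ℂ (eml : (Idx P → Matrix n n ℂ) → Matrix n n ℂ)
            (fun i => ((loopHol (Averaging.iter (fun i => blockAvg (P := P) (j := i) (expMeanLogSU (n := n))) k U₀) c i : Matrix.specialUnitaryGroup n ℂ) : Matrix n n ℂ))
            (fun i => covWalkSum (Averaging.iter (fun i => blockAvg (P := P) (j := i) (expMeanLogSU (n := n))) k U₀) (G k) (walk (emb c.src) (loopWord P.L c.dir (off i.1) i.2.1 i.2.2))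
              * ((loopHol (Averaging.iter (fun i => blockAvg (P := P) (j := i) (expMeanLogSU (n := n))) k U₀) c i : Matrix.specialUnitaryGroup n ℂ) : Matrix n n ℂ))
            * star ((corr (expMeanLogSU (n := n)) (Averaging.iter (fun i => blockAvg (P := P) (j := i) (expMeanLogSU (n := n))) k U₀) c : Matrix.specialUnitaryGroup n ℂ) : Matrix n n ℂ)
          + ((corr (expMeanLogSU (n := n)) (Averaging.iter (fun i => blockAvg (P := P) (j := i) (expMeanLogSU (n := n))) k U₀) c : Matrix.specialUnitaryGroup n ℂ) : Matrix n n ℂ)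
            * covWalkSum (Averaging.iter (fun i => blockAvg (P := P) (j := i) (expMeanLogSU (n := n))) k U₀) (G k) (walk (emb c.src) (List.replicate P.L (c.dir, true)))
            * star ((corr (expMeanLogSU (n := n)) (Averaging.iter (fun i => blockAvg (P := P) (j := i) (expMeanLogSU (n := n))) k U₀) c : Matrix.specialUnitaryGroup n ℂ) : Matrix n n ℂ))
        - ((((Fintype.card (Idx P) : ℂ))⁻¹ • ∑ i : Idx P,
              covWalkSum (Averaging.iter (fun i => blockAvg (P := P) (j := i) (expMeanLogSU (n := n))) k U₀) (G k) (walk (emb c.src) (stairWord i.2.1 (off i.1))))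
            - ((Averaging.iter (fun i => blockAvg (P := P) (j := i) (expMeanLogSU (n := n))) (k + 1) U₀ c : Matrix.specialUnitaryGroup n ℂ) : Matrix n n ℂ)
              * (((Fintype.card (Idx P) : ℂ))⁻¹ • ∑ i : Idx P,
              covWalkSum (Averaging.iter (fun i => blockAvg (P := P) (j := i) (expMeanLogSU (n := n))) k U₀) (G k) (walk (emb c.tgt) (stairWord i.2.1 (off i.1))))
              * star ((Averaging.iter (fun i => blockAvg (P := P) (j := i) (expMeanLogSU (n := n))) (k + 1) U₀ c : Matrix.specialUnitaryGroup n ℂ) : Matrix n n ℂ))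
        + R k c)
  (Λ : (k : ℕ) → Site P k → Matrix n n ℂ) (hΛ0 : ∀ y, Λ 0 y = 0)
  (hΛs : ∀ (k : ℕ) (z : Site P (k + 1)), Λ (k + 1) z
    = (((Fintype.card (Idx P) : ℂ))⁻¹ • ∑ i : Idx P,
              covWalkSum (Averaging.iter (fun i => blockAvg (P := P) (j := i) (expMeanLogSU (n := n))) k U₀) (G k) (walk (emb z) (stairWord i.2.1 (off i.1))))
      + Λ k (emb z))
  (osc : (j : ℕ) → (PBond P j → Matrix n n ℂ) → ℝ) (hosc0 : ∀ (j : ℕ) (W : PBond P j → Matrix n n ℂ), 0 ≤ osc j W)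
  (hosc_add : ∀ (j : ℕ) (A B : PBond P j → Matrix n n ℂ), osc j (A + B) ≤ osc j A + osc j B)
  {c₀ : ℝ} (hc₀ : 0 ≤ c₀) (hosc_le : ∀ (j : ℕ) (W : PBond P (j + 1) → Matrix n n ℂ), osc (j + 1) W ≤ c₀ * ∑ c : PBond P (j + 1), ‖W c‖)

include hDs hG0 hGs hΛ0 hΛs hosc0 hosc_add hc₀ hosc_le in
/-- ★★ **THE TWO-CHANNEL DAMPED `ℓ¹` ENGINE.**  `D_{j+1} = T_jD_j + R_j` along the tower `Ū₀^{(j)}` (`k ≤ m + K`), ANY initial field (`G_0 = D_0`); `G`, `Λ` the sourced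
reduced family and the coarse gauge function of record (A1); loop sizes `dist1(W^{(j)}_i(c)) ≤ a j ≤ 1/24`, `0 ≤ a j < δ_N`; an oscillation functional `osc` (nonnegative,
subadditive, `osc_{j+1} ≤ c₀‖·‖_{ℓ¹}`) with the two DISPLAYED one-level rows, for all `j < k` and all `Z`:
(CM-osc) `Σ_z‖CM_jZ(z)‖ ≤ c₁·osc_j(Z) + c₂·w_j·Σ_b‖Z b‖`;  (LINE-osc) `osc_{j+1}(LINE_jZ) ≤ ρ₂·osc_j(Z) + c₃·w_j·Σ_b‖Z b‖` (leak weights `w_j ≥ 0`, e.g. the level-`j`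
plaquette ∕ loop sizes; `ρ₂ > 0`, `c₁, c₂, c₃ ≥ 0`).  Then, with `ρ₁ = (L^d)⁻¹L`, `κ₁ = 159(d+2)L·2d`, `E_j = exp((κ₁∕ρ₁)Σ_{i<j}a_i)`,
`u_j = ρ₁ʲΣ_b‖D 0 b‖ + Σ_{i<j}ρ₁^{j−1−i}Σ_c‖R i c‖`, `t_i = (c₀κ₁a_i + c₃w_i)·(E_i·u_i) + osc_{i+1}(R_i)`:
`Σ_c‖D k c‖ ≤ E_k·u_k + 2d·Σ_{j<k}(c₁·(ρ₂ʲ·osc_0(D_0) + Σ_{i<j}ρ₂^{j−1−i}·t_i) + c₂·w_j·(E_j·u_j))` — every weight displayed, none collapsed.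
[cite: Balaban1984PropagatorsI, (1.18)-(1.20) pp.19-20; Balaban1985Averaging, Prop. 3 (124)-(126) p.36] -/
theorem sum_norm_sourced_le_osc (a : ℕ → ℝ) (ha0 : ∀ j, 0 ≤ a j) {k : ℕ} (hk : k ≤ P.m + P.K)
    (hα : ∀ j < k, ∀ (c : PBond P (j + 1)) (i : Idx P), dist1 (loopHol (Averaging.iter (fun i => blockAvg (P := P) (j := i) (expMeanLogSU (n := n))) j U₀) c i) ≤ a j)
    (ha24 : ∀ j < k, a j ≤ 1 / 24) (haN : ∀ j < k, a j < deltaSU n)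
    (w : ℕ → ℝ) (hw0 : ∀ j, 0 ≤ w j) {ρ₂ c₁ c₂ c₃ : ℝ} (hρ₂ : 0 < ρ₂) (hc₁ : 0 ≤ c₁) (hc₂ : 0 ≤ c₂) (hc₃ : 0 ≤ c₃)
    (hCM : ∀ j < k, ∀ Z : PBond P j → Matrix n n ℂ, ∑ z : Site P (j + 1), ‖(((Fintype.card (Idx P) : ℂ))⁻¹ • ∑ i : Idx P,
              covWalkSum (Averaging.iter (fun i => blockAvg (P := P) (j := i) (expMeanLogSU (n := n))) j U₀) Z (walk (emb z) (stairWord i.2.1 (off i.1))))‖ ≤ c₁ * osc j Z + c₂ * w j * ∑ b : PBond P j, ‖Z b‖)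
    (hLINE : ∀ j < k, ∀ Z : PBond P j → Matrix n n ℂ, osc (j + 1) (fun c => (((Fintype.card (Idx P) : ℂ))⁻¹ • ∑ i : Idx P,
          ((holAt (Averaging.iter (fun i => blockAvg (P := P) (j := i) (expMeanLogSU (n := n))) j U₀) (walk (emb c.src) (stairWord i.2.1 (off i.1))) : Matrix.specialUnitaryGroup n ℂ) : Matrix n n ℂ) *
            covWalkSum (Averaging.iter (fun i => blockAvg (P := P) (j := i) (expMeanLogSU (n := n))) j U₀) Z (walk (walkEnd (emb c.src) (stairWord i.2.1 (off i.1))) (List.replicate P.L (c.dir, true))) *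
          star ((holAt (Averaging.iter (fun i => blockAvg (P := P) (j := i) (expMeanLogSU (n := n))) j U₀) (walk (emb c.src) (stairWord i.2.1 (off i.1))) : Matrix.specialUnitaryGroup n ℂ) : Matrix n n ℂ))) ≤ ρ₂ * osc j Z + c₃ * w j * ∑ b : PBond P j, ‖Z b‖) :
    ∑ c : PBond P k, ‖D k c‖
      ≤ Real.exp ((159 * (((P.d + 2) * P.L : ℕ) : ℝ) * (2 * P.d)) / (((P.L : ℝ) ^ P.d)⁻¹ * (P.L : ℝ)) * ∑ i ∈ Finset.range k, a i) * ((((P.L : ℝ) ^ P.d)⁻¹ * (P.L : ℝ)) ^ k * (∑ b : PBond P 0, ‖D 0 b‖) + ∑ l ∈ Finset.range k, (((P.L : ℝ) ^ P.d)⁻¹ * (P.L : ℝ)) ^ (k - 1 - l) * ∑ c : PBond P (l + 1), ‖R l c‖)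
        + 2 * P.d * ∑ j ∈ Finset.range k,
            (c₁ * (ρ₂ ^ j * osc 0 (D 0) + ∑ i ∈ Finset.range j, ρ₂ ^ (j - 1 - i) * ((c₀ * (159 * (((P.d + 2) * P.L : ℕ) : ℝ) * (2 * P.d)) * a i + c₃ * w i) * (Real.exp ((159 * (((P.d + 2) * P.L : ℕ) : ℝ) * (2 * P.d)) / (((P.L : ℝ) ^ P.d)⁻¹ * (P.L : ℝ)) * ∑ i ∈ Finset.range i, a i) * ((((P.L : ℝ) ^ P.d)⁻¹ * (P.L : ℝ)) ^ i * (∑ b : PBond P 0, ‖D 0 b‖) + ∑ l ∈ Finset.range i, (((P.L : ℝ) ^ P.d)⁻¹ * (P.L : ℝ)) ^ (i - 1 - l) * ∑ c : PBond P (l + 1), ‖R l c‖)) + osc (i + 1) (R i)))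
              + c₂ * w j * (Real.exp ((159 * (((P.d + 2) * P.L : ℕ) : ℝ) * (2 * P.d)) / (((P.L : ℝ) ^ P.d)⁻¹ * (P.L : ℝ)) * ∑ i ∈ Finset.range j, a i) * ((((P.L : ℝ) ^ P.d)⁻¹ * (P.L : ℝ)) ^ j * (∑ b : PBond P 0, ‖D 0 b‖) + ∑ l ∈ Finset.range j, (((P.L : ℝ) ^ P.d)⁻¹ * (P.L : ℝ)) ^ (j - 1 - l) * ∑ c : PBond P (l + 1), ‖R l c‖))) := by
  -- the (0.4) guards from the loop sizes
  have hg : ∀ j < k, ∀ (c : PBond P (j + 1)) (i : Idx P),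
      dist1 (loopHol (Averaging.iter (fun i => blockAvg (P := P) (j := i) (expMeanLogSU (n := n))) j U₀) c i) < deltaSU n :=
    fun j hj c i => (hα j hj c i).trans_lt (haN j hj)
  have hκ0 : (0 : ℝ) ≤ (159 * (((P.d + 2) * P.L : ℕ) : ℝ) * (2 * P.d)) := by positivity
  -- `‖D_k‖₁ ≤ ‖G_k‖₁ + 2d·‖Λ_k‖₁`
  have hpt : ∀ c : PBond P k, ‖D k c‖ ≤ ‖G k c‖ + (‖Λ k c.tgt‖ + ‖Λ k c.src‖) := fun c => by
    have h := norm_le_of_sourced_structure U₀ D R hDs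
      (fun k Gk z => ((Fintype.card (Idx P) : ℂ))⁻¹ • ∑ i : Idx P,
        covWalkSum (Averaging.iter (fun i => blockAvg (P := P) (j := i) (expMeanLogSU (n := n))) k U₀) Gk (walk (emb z) (stairWord i.2.1 (off i.1))))
      G Λ hG0 hΛ0 hΛs hGs hg c
    linarith
  have h1 : ∑ c : PBond P k, ‖D k c‖ ≤ ∑ c : PBond P k, ‖G k c‖ + 2 * P.d * ∑ y : Site P k, ‖Λ k y‖ := by
    calc ∑ c : PBond P k, ‖D k c‖ ≤ ∑ c : PBond P k, (‖G k c‖ + (‖Λ k c.tgt‖ + ‖Λ k c.src‖)) := Finset.sum_le_sum fun c _ => hpt c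
      _ = ∑ c : PBond P k, ‖G k c‖ + 2 * P.d * ∑ y : Site P k, ‖Λ k y‖ := by
          rw [Finset.sum_add_distrib, sum_pbond_tgt_add_src (fun y => ‖Λ k y‖)]
  -- the G-channel (✓ 1b), at every level `j ≤ k`
  have hG0sum : ∑ b : PBond P 0, ‖G 0 b‖ = (∑ b : PBond P 0, ‖D 0 b‖) := Finset.sum_congr rfl fun b _ => by rw [hG0]
  have hGj : ∀ j ≤ k, ∑ c : PBond P j, ‖G j c‖ ≤ Real.exp ((159 * (((P.d + 2) * P.L : ℕ) : ℝ) * (2 * P.d)) / (((P.L : ℝ) ^ P.d)⁻¹ * (P.L : ℝ)) * ∑ i ∈ Finset.range j, a i) * ((((P.L : ℝ) ^ P.d)⁻¹ * (P.L : ℝ)) ^ j * (∑ b : PBond P 0, ‖D 0 b‖) + ∑ l ∈ Finset.range j, (((P.L : ℝ) ^ P.d)⁻¹ * (P.L : ℝ)) ^ (j - 1 - l) * ∑ c : PBond P (l + 1), ‖R l c‖) := by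
    intro j hjk
    have h := sum_norm_sourcedReduced_le U₀ R G hGs a ha0 (hjk.trans hk) (fun i hi => hα i (hi.trans_le hjk))
      (fun i hi => ha24 i (hi.trans_le hjk)) (fun i hi => haN i (hi.trans_le hjk))
    rw [hG0sum] at h
    exact h
  have hEU0 : ∀ j, 0 ≤ Real.exp ((159 * (((P.d + 2) * P.L : ℕ) : ℝ) * (2 * P.d)) / (((P.L : ℝ) ^ P.d)⁻¹ * (P.L : ℝ)) * ∑ i ∈ Finset.range j, a i) * ((((P.L : ℝ) ^ P.d)⁻¹ * (P.L : ℝ)) ^ j * (∑ b : PBond P 0, ‖D 0 b‖) + ∑ l ∈ Finset.range j, (((P.L : ℝ) ^ P.d)⁻¹ * (P.L : ℝ)) ^ (j - 1 - l) * ∑ c : PBond P (l + 1), ‖R l c‖) := fun j =>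
    mul_nonneg (Real.exp_nonneg _) (add_nonneg (mul_nonneg (pow_nonneg (by positivity) _) (Finset.sum_nonneg fun b _ => norm_nonneg _))
      (Finset.sum_nonneg fun i _ => mul_nonneg (pow_nonneg (by positivity) _) (Finset.sum_nonneg fun c _ => norm_nonneg _)))
  -- the oscillation channel: rows and the damped recursion
  have ht0 : ∀ i, 0 ≤ ((c₀ * (159 * (((P.d + 2) * P.L : ℕ) : ℝ) * (2 * P.d)) * a i + c₃ * w i) * (Real.exp ((159 * (((P.d + 2) * P.L : ℕ) : ℝ) * (2 * P.d)) / (((P.L : ℝ) ^ P.d)⁻¹ * (P.L : ℝ)) * ∑ i ∈ Finset.range i, a i) * ((((P.L : ℝ) ^ P.d)⁻¹ * (P.L : ℝ)) ^ i * (∑ b : PBond P 0, ‖D 0 b‖) + ∑ l ∈ Finset.range i, (((P.L : ℝ) ^ P.d)⁻¹ * (P.L : ℝ)) ^ (i - 1 - l) * ∑ c : PBond P (l + 1), ‖R l c‖)) + osc (i + 1) (R i)) := fun i =>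
    add_nonneg (mul_nonneg (add_nonneg (mul_nonneg (mul_nonneg hc₀ hκ0) (ha0 i)) (mul_nonneg hc₃ (hw0 i))) (hEU0 i)) (hosc0 _ _)
  have horow : ∀ j < k, osc (j + 1) (G (j + 1)) ≤ ρ₂ * osc j (G j) + ((c₀ * (159 * (((P.d + 2) * P.L : ℕ) : ℝ) * (2 * P.d)) * a j + c₃ * w j) * (Real.exp ((159 * (((P.d + 2) * P.L : ℕ) : ℝ) * (2 * P.d)) / (((P.L : ℝ) ^ P.d)⁻¹ * (P.L : ℝ)) * ∑ i ∈ Finset.range j, a i) * ((((P.L : ℝ) ^ P.d)⁻¹ * (P.L : ℝ)) ^ j * (∑ b : PBond P 0, ‖D 0 b‖) + ∑ l ∈ Finset.range j, (((P.L : ℝ) ^ P.d)⁻¹ * (P.L : ℝ)) ^ (j - 1 - l) * ∑ c : PBond P (l + 1), ‖R l c‖)) + osc (j + 1) (R j)) := by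
    intro j hj
    have h := osc_sourcedReduced_succ_le U₀ R G hGs osc hosc_add hc₀ hosc_le (by omega) (ha0 j) (hα j hj) (ha24 j hj) (haN j hj) (hLINE j hj)
    have hmono : (c₀ * (159 * (((P.d + 2) * P.L : ℕ) : ℝ) * (2 * P.d)) * a j + c₃ * w j) * ∑ c : PBond P j, ‖G j c‖ ≤ (c₀ * (159 * (((P.d + 2) * P.L : ℕ) : ℝ) * (2 * P.d)) * a j + c₃ * w j) * (Real.exp ((159 * (((P.d + 2) * P.L : ℕ) : ℝ) * (2 * P.d)) / (((P.L : ℝ) ^ P.d)⁻¹ * (P.L : ℝ)) * ∑ i ∈ Finset.range j, a i) * ((((P.L : ℝ) ^ P.d)⁻¹ * (P.L : ℝ)) ^ j * (∑ b : PBond P 0, ‖D 0 b‖) + ∑ l ∈ Finset.range j, (((P.L : ℝ) ^ P.d)⁻¹ * (P.L : ℝ)) ^ (j - 1 - l) * ∑ c : PBond P (l + 1), ‖R l c‖)) :=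
      mul_le_mul_of_nonneg_left (hGj j hj.le) (add_nonneg (mul_nonneg (mul_nonneg hc₀ hκ0) (ha0 j)) (mul_nonneg hc₃ (hw0 j)))
    linarith
  have hG0osc : osc 0 (G 0) = osc 0 (D 0) := by rw [show G 0 = D 0 from funext hG0]
  have hoj : ∀ j ≤ k, osc j (G j) ≤ (ρ₂ ^ j * osc 0 (D 0) + ∑ i ∈ Finset.range j, ρ₂ ^ (j - 1 - i) * ((c₀ * (159 * (((P.d + 2) * P.L : ℕ) : ℝ) * (2 * P.d)) * a i + c₃ * w i) * (Real.exp ((159 * (((P.d + 2) * P.L : ℕ) : ℝ) * (2 * P.d)) / (((P.L : ℝ) ^ P.d)⁻¹ * (P.L : ℝ)) * ∑ i ∈ Finset.range i, a i) * ((((P.L : ℝ) ^ P.d)⁻¹ * (P.L : ℝ)) ^ i * (∑ b : PBond P 0, ‖D 0 b‖) + ∑ l ∈ Finset.range i, (((P.L : ℝ) ^ P.d)⁻¹ * (P.L : ℝ)) ^ (i - 1 - l) * ∑ c : PBond P (l + 1), ‖R l c‖)) + osc (i + 1) (R i))) := by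
    intro j hjk
    have h := damped_recursion_bound hρ₂ (fun i => osc i (G i)) (fun i => ((c₀ * (159 * (((P.d + 2) * P.L : ℕ) : ℝ) * (2 * P.d)) * a i + c₃ * w i) * (Real.exp ((159 * (((P.d + 2) * P.L : ℕ) : ℝ) * (2 * P.d)) / (((P.L : ℝ) ^ P.d)⁻¹ * (P.L : ℝ)) * ∑ i ∈ Finset.range i, a i) * ((((P.L : ℝ) ^ P.d)⁻¹ * (P.L : ℝ)) ^ i * (∑ b : PBond P 0, ‖D 0 b‖) + ∑ l ∈ Finset.range i, (((P.L : ℝ) ^ P.d)⁻¹ * (P.L : ℝ)) ^ (i - 1 - l) * ∑ c : PBond P (l + 1), ‖R l c‖)) + osc (i + 1) (R i))) (fun i => hosc0 _ _) ht0 j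
      (fun i hi => horow i (hi.trans_le hjk))
    rw [hG0osc] at h
    exact h
  -- the Λ-channel in oscillation currency
  have hΛ := sum_norm_sourcedGauge_le_osc U₀ G Λ hΛ0 hΛs osc w hk hCM
  have hΛ' : ∑ y : Site P k, ‖Λ k y‖ ≤ ∑ j ∈ Finset.range k, (c₁ * (ρ₂ ^ j * osc 0 (D 0) + ∑ i ∈ Finset.range j, ρ₂ ^ (j - 1 - i) * ((c₀ * (159 * (((P.d + 2) * P.L : ℕ) : ℝ) * (2 * P.d)) * a i + c₃ * w i) * (Real.exp ((159 * (((P.d + 2) * P.L : ℕ) : ℝ) * (2 * P.d)) / (((P.L : ℝ) ^ P.d)⁻¹ * (P.L : ℝ)) * ∑ i ∈ Finset.range i, a i) * ((((P.L : ℝ) ^ P.d)⁻¹ * (P.L : ℝ)) ^ i * (∑ b : PBond P 0, ‖D 0 b‖) + ∑ l ∈ Finset.range i, (((P.L : ℝ) ^ P.d)⁻¹ * (P.L : ℝ)) ^ (i - 1 - l) * ∑ c : PBond P (l + 1), ‖R l c‖)) + osc (i + 1) (R i))) + c₂ * w j * (Real.exp ((159 * (((P.d + 2) * P.L : ℕ)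 : ℝ) * (2 * P.d)) / (((P.L : ℝ) ^ P.d)⁻¹ * (P.L : ℝ)) * ∑ i ∈ Finset.range j, a i) * ((((P.L : ℝ) ^ P.d)⁻¹ * (P.L : ℝ)) ^ j * (∑ b : PBond P 0, ‖D 0 b‖) + ∑ l ∈ Finset.range j, (((P.L : ℝ) ^ P.d)⁻¹ * (P.L : ℝ)) ^ (j - 1 - l) * ∑ c : PBond P (l + 1), ‖R l c‖))) :=
    hΛ.trans (Finset.sum_le_sum fun j hj => by
      have hjk := (Finset.mem_range.mp hj).le
      exact add_le_add (mul_le_mul_of_nonneg_left (hoj j hjk) hc₁) (mul_le_mul_of_nonneg_left (hGj j hjk) (mul_nonneg hc₂ (hw0 j))))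
  have hd0 : (0 : ℝ) ≤ 2 * P.d := by positivity
  have := mul_le_mul_of_nonneg_left hΛ' hd0
  linarith [h1, hGj k le_rfl, this]

end Assembly

end Summit.QuantumFields.YangMills.Theorems.Prop7TrueLinSourcedOscL1

end
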